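import Mathlib
import HarnessLib
import Summits.ResolutionOfSingularities.ResolutionOfSingularities.Theorems.WildQuotientsWildQuotientResolutionCyclicTransferInvariants
import Summits.ResolutionOfSingularities.ResolutionOfSingularities.Theorems.WildQuotientsWildQuotientResolutionCyclicTransferIsRegularGlued
import Summits.ResolutionOfSingularities.ResolutionOfSingularities.Theorems.WildQuotientsWildQuotientResolutionCyclicTransferStalkAugRestrict
import Summits.ResolutionOfSingularities.ResolutionOfSingularities.Theorems.WildQuotientsWildQuotientResolutionStubQuotientModel
import Summits.ResolutionOfSingularities.ResolutionOfSingularities.Theorems.WildQuotientsWildQuotientResolutionStubBirational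
import Literature.AlgebraicGeometry.Resolution.ComponentGluing

/-!
# Cyclic divisorial transfer: Király–Lütkebohmert terminal state ⟹ resolution of the quotient

Crux stmt-ResolutionOfSingularities-15640 (`WildQuotients.WildQuotientResolution`), line `Sketch`,
REGISTERED stub `cyclicDivisorialTransfer` (the geometric assembly of the cyclic divisorial
transfer, lead c8's `Lines/Sketch_CyclicTransferGeom.lean`; [OURS · L1 W4.5c] sub-line T1 of the
chain's plan of record — NOT a statement of the manuscript): for the crux data
`(X′, X₁, q, G, ρ)` with `ρ` faithful, `|G| = p` and `dim X₁ > 0`, a `G`-equivariant proper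
birational REGULAR integral model `π : V → X′` covered by `G`-stable affine opens on which, at
every fixed point `v` of every `g ∈ G`, the augmentation ideal `(g♯ s - s : s ∈ 𝒪_{V,v})` of the
stalk action is principal, gives `Scheme.HasResolution X₁`.

Proof: `Y₁ := V/G` (the glued quotient `ActionOver.glued` over `X₁`,
`Literature.AlgebraicGeometry.RelativeSpec.FiniteGroupQuotientGluing`) maps properly
(`ActionOver.isProper_gluedDesc`) and birationally (the `W`-clause
`QuotientModel.exists_dense_isFinite_etale_bijective` + lemma (L)
`Birational.stub_birational_of_bijective`) onto `X₁`, and `Y₁` is REGULAR (`cdt_isRegular_glued`):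
by `stub_isRegular_glued` it suffices that every chart ring `Γ(O, (O ↪ V → X₁)⁻¹U)^G` is
regular, which is the chart form `isRegularRing_invariantsRing_of_locallyOfFiniteType` of the
transfer (Király–Lütkebohmert at fixed primes, Chase–Harrison–Rosenberg flatness + flat descent at
moved primes; `isRegularRing_eqLocus`) applied to the restricted action on `O`, whose stalk
hypothesis is inherited from `V` (`stub_stalkAug_restrict`). Resolutions transfer along proper
birational morphisms (`ComponentGluing.Scheme.HasResolution.of_isBirational`).
-/

-- single-problem summit: the doubled namespace component `ResolutionOfSingularities` is forced
set_option linter.dupNamespace false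

noncomputable section

open CategoryTheory Limits AlgebraicGeometry TopologicalSpace
open Literature.AlgebraicGeometry.Resolution Literature.AlgebraicGeometry.RelativeSpec

namespace Summit.ResolutionOfSingularities.ResolutionOfSingularities.Theorems.WildQuotientResolution.CyclicTransfer

/-! ## Regularity of the glued quotient `V/G` -/

section Glued

variable {X Y : Scheme.{0}} {r : X ⟶ Y} {G : Type} [Group G] [Finite G] (ρ : ActionOver r G)
  [Y.IsSeparated] [IsSeparated r] [IsIntegral X] [LocallyOfFiniteType r] [IsLocallyNoetherian Y]

/-- **`X/G` is regular in the Király–Lütkebohmert terminal state** (this file's own copy of the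
chain's helper A2, prefixed `cdt_` per the plan of record). For a group `G` of prime order `p`
acting over a separated locally Noetherian base `Y` (`r : X → Y` separated, locally of finite
type) on a regular integral scheme `X` such that at every fixed point `x` of every `g ∈ G` the
augmentation ideal of the stalk action of `g` on `𝒪_{X,x}` is principal, the glued quotient
`X/G` (`ActionOver.glued`) is a regular scheme: by `stub_isRegular_glued` it suffices that the
chart rings `Γ(O, (O ↪ X → Y)⁻¹U)^G` (`O` a `G`-stable open affine over `Y`, `U ⊆ Y` affine
open) are regular; for `O` empty this is the zero ring, and for `O` non-empty it is the ring of
invariants of the restricted action on the regular integral `O`, which satisfies the same stalk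
hypothesis (`stub_stalkAug_restrict`), so that the chart form
`isRegularRing_invariantsRing_of_locallyOfFiniteType` (res-L1-w45c-stub-1) applies.
[cite: KiralyLutkebohmert2013, Thm 2] [cite: SGA1, Exp. V, §1, Prop. 1.8] -/
theorem cdt_isRegular_glued {p : ℕ} (hp : p.Prime) (hcard : Nat.card G = p)
    (hreg : Scheme.IsRegular X)
    (hdiv : ∀ (g : G) (x : X) (hx : (ρ.aut g).hom.base x = x),
      (Ideal.span (Set.range fun s : X.presheaf.stalk x =>
        (X.presheaf.stalkSpecializes (specializes_of_eq hx) ≫ (ρ.aut g).hom.stalkMap x).hom s -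
          s)).IsPrincipal) :
    Scheme.IsRegular ρ.glued := by
  classical
  refine stub_isRegular_glued ρ fun O U => ?_
  rw [ActionOver.invariants_ring]
  -- the restricted action on the stable open `O`, affine over `Y`
  set ρO := ρ.restrict O.1 O.2.1 with hρO
  -- the stalk hypothesis for the restricted action
  have hdivO : ∀ (g : G) (x : (O.1 : Scheme.{0})) (hx : (ρO.aut g).hom.base x = x),
      (Ideal.span (Set.range fun s : (O.1 : Scheme.{0}).presheaf.stalk x =>
        ((O.1 : Scheme.{0}).presheaf.stalkSpecializes (specializes_of_eq hx) ≫
          (ρO.aut g).hom.stalkMap x).hom s - s)).IsPrincipal := by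
    intro g x hx
    have hgx : (ρ.aut g).hom.base x.1 = x.1 := by
      have h1 := ρ.ι_restrictHom_apply O.1 O.2.1 g x
      simp only [Scheme.Opens.ι_apply] at h1
      rw [← ActionOver.restrict_aut_hom] at h1
      rw [← h1]
      exact congrArg Subtype.val hx
    obtain ⟨_, h⟩ := stub_stalkAug_restrict ρ O.1 O.2.1 g x hgx (hdiv g x.1 hgx)
    exact h
  by_cases hO : Nonempty (O.1 : Scheme.{0})
  · -- non-empty stable open: a regular integral scheme, affine and of finite type over `Y`
    haveI := hO
    haveI : IsIntegral (O.1 : Scheme.{0}) := isIntegral_of_isOpenImmersion O.1.ι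
    have hOreg : Scheme.IsRegular (O.1 : Scheme.{0}) := fun x => by
      haveI := hreg (O.1.ι.base x)
      exact IsRegularLocalRing.of_ringEquiv (asIso (O.1.ι.stalkMap x)).commRingCatIsoToRingEquiv
    exact isRegularRing_invariantsRing_of_locallyOfFiniteType ρO hp hcard hOreg U hdivO
  · -- empty stable open: the chart ring is the zero ring
    have hbot : ((O.1.ι ≫ r) ⁻¹ᵁ U.1 : (O.1 : Scheme.{0}).Opens) = ⊥ := by
      ext x
      exact absurd ⟨x⟩ hO
    haveI : Subsingleton Γ((O.1 : Scheme.{0}), (O.1.ι ≫ r) ⁻¹ᵁ U.1) :=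
      CommRingCat.subsingleton_of_isTerminal ((O.1 : Scheme.{0}).sheaf.isTerminalOfEqEmpty hbot)
    haveI : Subsingleton (Ideal (ρO.invariantsRing U.1)) :=
      (Submodule.subsingleton_iff _).mpr inferInstance
    haveI : IsNoetherianRing (ρO.invariantsRing U.1) := inferInstance
    exact isRegularRing_iff.mpr fun 𝔭 h𝔭 => absurd (Subsingleton.elim 𝔭 ⊤) h𝔭.ne_top

end Glued

/-! ## The transfer -/

/-- **Cyclic divisorial transfer** (the route's `CyclicDivisorialModel ⟹ crux` step for `|G| = p`, K–L being
proved): for the crux data `(X′, X₁, q, G, ρ)` with `ρ` faithful, `|G| = p` and `dim X₁ > 0`, a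
`G`-equivariant proper birational REGULAR integral model `π : V → X′` with a `G`-stable affine cover on which,
at every `G`-fixed point `v`, the augmentation ideal `(g♯ s - s : s ∈ 𝒪_{V,v})` of the stalk action of every
`g` is principal (the Király–Lütkebohmert terminal state), gives a resolution of `X₁`: the quotient
`Y₁ = V/G → X₁` (`QuotientModelNormal`) is proper birational, and `Y₁` is REGULAR — at the image of a fixed
point by Király–Lütkebohmert Thm 2 (`Theorems.kl_isRegularLocalRing_eqLocus`, `(B^σ)_𝔭 = (B_𝔮)^σ`), at the
image of a free point because `V → V/G` is flat there (Chase–Harrison–Rosenberg) and regularity descends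
along flat local maps. [cite: KiralyLutkebohmert2013, Thm 2] [cite: SGA1, Exp. V, Prop. 2.2] -/
theorem cyclicDivisorialTransfer (p : ℕ) (hp : p.Prime) (k : Type) [Field k] [CharP k p]
    (X' X₁ : Scheme.{0}) (f : X₁ ⟶ Spec (.of k)) (q : X' ⟶ X₁) (G : Type) [Group G] [Finite G]
    (ρ : G →* Aut X') (hcard : Nat.card G = p) (hfaith : Function.Injective ρ)
    [IsSeparated f] [LocallyOfFiniteType f] [QuasiCompact f] [IsIntegral X₁] [IsIntegral X']
    [IsFinite q] (hdim : ¬ topologicalKrullDim X₁ ≤ 0) (hsurj : Function.Surjective q.base)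
    (hU : ∃ U : X₁.Opens, Dense (U : Set X₁) ∧ Etale (q ∣_ U))
    (hρ : ∀ g : G, (ρ g).hom ≫ q = q)
    (horb : ∀ x y : X', q.base x = q.base y → ∃ g : G, (ρ g).hom.base x = y)
    (V : Scheme.{0}) (π : V ⟶ X') (ρV : G →* Aut V) [IsProper π] (hbir : IsBirational π)
    [IsIntegral V] (hVreg : Scheme.IsRegular V)
    (hequiv : ∀ g : G, (ρV g).hom ≫ π = π ≫ (ρ g).hom)
    (hcov : ∀ v : V, ∃ W : V.Opens, IsAffineOpen W ∧ v ∈ W ∧ ∀ g : G, (ρV g).hom ⁻¹ᵁ W = W)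
    (hdiv : ∀ (g : G) (v : V) (hv : (ρV g).hom.base v = v),
      (Ideal.span (Set.range fun s : V.presheaf.stalk v =>
        (V.presheaf.stalkSpecializes (specializes_of_eq hv) ≫ (ρV g).hom.stalkMap v).hom s -
          s)).IsPrincipal) :
    Scheme.HasResolution X₁ := by
  classical
  -- separatedness and noetherianity downstairs
  haveI : X₁.IsSeparated := ⟨by rw [← terminal.comp_from f]; infer_instance⟩
  haveI : X'.IsSeparated := ⟨by rw [← terminal.comp_from (q ≫ f)]; infer_instance⟩
  haveI : IsLocallyNoetherian X₁ := LocallyOfFiniteType.isLocallyNoetherian f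
  -- the action over `X₁` and its cover by `G`-stable opens affine over `X₁`
  let ρB : ActionOver (π ≫ q) G :=
    ⟨ρV, fun g => by rw [← Category.assoc, hequiv g, Category.assoc, hρ g]⟩
  have hcov' : ∀ x : V, ∃ O : ρB.StableAffineOpens, x ∈ O.1 := by
    intro x
    obtain ⟨W, hW, hxW, hWst⟩ := hcov x
    haveI : IsAffine W := hW
    exact ⟨⟨W, hWst, isAffineHom_of_isAffine_of_isSeparated _⟩, hxW⟩
  -- the action on `V` is faithful: `π` is dominant onto the reduced separated `X′`
  haveI : IsDominant π := hbir.isDominant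
  have hinj : Function.Injective ρB.aut := by
    intro g₁ g₂ h
    rw [← inv_mul_eq_one]
    apply hfaith
    rw [map_one]
    have h1 : ρV (g₁⁻¹ * g₂) = 1 := by
      rw [map_mul, map_inv, inv_mul_eq_one]
      exact h
    have h2 : π ≫ (ρ (g₁⁻¹ * g₂)).hom = π ≫ 𝟙 X' := by
      rw [Category.comp_id, ← hequiv, h1]
      exact Category.id_comp π
    have h3 : (ρ (g₁⁻¹ * g₂)).hom = 𝟙 X' := ext_of_isDominant π h2
    ext : 1
    exact h3
  -- the quotient `Y₁ := V/G` over `X₁` and `r : Y₁ → X₁`, proper and birational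
  haveI hY₁ : IsIntegral ρB.glued := ρB.isIntegral_glued hcov'
  haveI hr : IsProper (ρB.gluedDesc (π ≫ q) ρB.aut_comp) :=
    ρB.isProper_gluedDesc hcov' (π ≫ q) ρB.aut_comp (𝟙 X₁) (Category.comp_id _)
  obtain ⟨W, hWd, hWfin, hWet, hWbij⟩ :=
    QuotientModel.exists_dense_isFinite_etale_bijective π q ρB hcov' hinj ρ hequiv horb hsurj hU
      hbir
  haveI := hWfin
  haveI := hWet
  have hrbir : IsBirational (ρB.gluedDesc (π ≫ q) ρB.aut_comp) :=
    Birational.stub_birational_of_bijective k f (ρB.gluedDesc (π ≫ q) ρB.aut_comp) hdim W hWd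
      hWbij
  -- `Y₁` is regular: the chart rings are fixed rings in the Király–Lütkebohmert terminal state
  have hY₁reg : Scheme.IsRegular ρB.glued :=
    cdt_isRegular_glued ρB hp hcard hVreg fun g v hv => hdiv g v hv
  exact ComponentGluing.Scheme.HasResolution.of_isBirational (ρB.gluedDesc (π ≫ q) ρB.aut_comp)
    hrbir hY₁reg.hasResolution

/-- **Cyclic divisorial transfer without faithfulness** (for `CyclicWildQuotient`-shaped data,
stmt-ResolutionOfSingularities-15644: `Nat.card G = p`, no `Function.Injective ρ`): the same
transfer as `cyclicDivisorialTransfer`. If `ρ` is faithful this is `cyclicDivisorialTransfer`;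
otherwise its kernel is a non-trivial subgroup of the group `G` of prime order, hence all of `G`,
so `G` acts trivially on `X′`, the fibres of `q` (the orbits) are points, `q` is finite,
surjective, generically étale and injective, hence birational over the positive-dimensional `X₁`
(lemma (L), `Birational.stub_birational_of_bijective`), and `V → X′ → X₁` is a resolution.
[OURS · L1 W4.5c, helper] [folklore] -/
theorem cyclicDivisorialTransfer_of_card (p : ℕ) (hp : p.Prime) (k : Type) [Field k] [CharP k p]
    (X' X₁ : Scheme.{0}) (f : X₁ ⟶ Spec (.of k)) (q : X' ⟶ X₁) (G : Type) [Group G] [Finite G]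
    (ρ : G →* Aut X') (hcard : Nat.card G = p)
    [IsSeparated f] [LocallyOfFiniteType f] [QuasiCompact f] [IsIntegral X₁] [IsIntegral X']
    [IsFinite q] (hdim : ¬ topologicalKrullDim X₁ ≤ 0) (hsurj : Function.Surjective q.base)
    (hU : ∃ U : X₁.Opens, Dense (U : Set X₁) ∧ Etale (q ∣_ U))
    (hρ : ∀ g : G, (ρ g).hom ≫ q = q)
    (horb : ∀ x y : X', q.base x = q.base y → ∃ g : G, (ρ g).hom.base x = y)
    (V : Scheme.{0}) (π : V ⟶ X') (ρV : G →* Aut V) [IsProper π] (hbir : IsBirational π)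
    [IsIntegral V] (hVreg : Scheme.IsRegular V)
    (hequiv : ∀ g : G, (ρV g).hom ≫ π = π ≫ (ρ g).hom)
    (hcov : ∀ v : V, ∃ W : V.Opens, IsAffineOpen W ∧ v ∈ W ∧ ∀ g : G, (ρV g).hom ⁻¹ᵁ W = W)
    (hdiv : ∀ (g : G) (v : V) (hv : (ρV g).hom.base v = v),
      (Ideal.span (Set.range fun s : V.presheaf.stalk v =>
        (V.presheaf.stalkSpecializes (specializes_of_eq hv) ≫ (ρV g).hom.stalkMap v).hom s -
          s)).IsPrincipal) :
    Scheme.HasResolution X₁ := by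
  classical
  by_cases hfaith : Function.Injective ρ
  · exact cyclicDivisorialTransfer p hp k X' X₁ f q G ρ hcard hfaith hdim hsurj hU hρ horb V π ρV
      hbir hVreg hequiv hcov hdiv
  · -- the kernel of `ρ` is all of `G`: the action on `X′` is trivial
    haveI : Fact (Nat.card G).Prime := ⟨hcard ▸ hp⟩
    have hker : ρ.ker = ⊤ := by
      rcases ρ.ker.eq_bot_or_eq_top_of_prime_card with h | h
      · exact absurd ((MonoidHom.ker_eq_bot_iff ρ).mp h) hfaith
      · exact h
    have htriv : ∀ g : G, ρ g = 1 := fun g => by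
      have hg : g ∈ ρ.ker := hker ▸ Subgroup.mem_top g
      exact hg
    -- `q` is injective (its fibres are the orbits), hence bijective over the étale locus `U`
    have hinj : Function.Injective q.base := fun x y hxy => by
      obtain ⟨g, hg⟩ := horb x y hxy
      rw [htriv g] at hg
      exact hg
    obtain ⟨U, hUd, hUet⟩ := hU
    haveI := hUet
    have hbij : Function.Bijective (q ∣_ U).base := by
      rw [morphismRestrict_base]
      exact Set.restrictPreimage_bijective _ ⟨hinj, hsurj⟩
    -- `q` is birational (lemma (L)), and `V → X′ → X₁` resolves `X₁`
    have hqbir : IsBirational q := Birational.stub_birational_of_bijective k f q hdim U hUd hbij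
    exact ComponentGluing.Scheme.HasResolution.of_isBirational q hqbir
      (ComponentGluing.Scheme.HasResolution.of_isBirational π hbir hVreg.hasResolution)

end Summit.ResolutionOfSingularities.ResolutionOfSingularities.Theorems.WildQuotientResolution.CyclicTransfer

end
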